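/-
Origin: expansion seat `planner-pub-hodgecm-mc-glue-1-g5-0`, handover #338 2026-08-19T11:30Z md5 f902af78bd73e18ae4180c124cedf1ef NEW additive PKG Model leaf (230 l.; imports `HodgeCM.Proofs.HermitianDiagonalize` ONLY (unitary-1-g3, RUN 33, a leaf imported today only by `AxiomAudit` — no cycle)): THE RATIONAL ORTHOGONAL FRAME OF RECORD `HodgeCM.HermSpace3.rationalFrame V : GL (Fin 3) L := V.exists_rational_frame.choose`, its diagonal `rationalFrame_d V : Fin 3 → L` with `rationalFrame_d_conj` (σ dᵢ = dᵢ), `rationalFrame_d_ne_zero`, `rationalFrame_diag` (ᵗ(σg)·Hm·g = diagonal d) — consumers (unitary-1 `WmInstanceV2`, binder-2 `HypCensus/*`, (J-x₀) §50 `frameG`) import THIS def instead of writing `.choose`; at ι₁: `rationalFrameC V : GL (Fin 3) ℂ` (= g.map ι₁, `coe_rationalFrameC` rfl), the reals `rationalFrame_r V i` with `rationalFrame_r_coe : (r i : ℂ) = ι₁ (d i)`, `rationalFrame_r_ne_zero`, `rationalFrame_diag_ι₁ : Gᴴ · Hm^{ι₁} · G = diagonal (r : ℂ)`; SIGNS (K-grade,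 no inertia theorem): `prod_rationalFrame_r_neg : r₀ r₁ r₂ < 0` (det Hm^{ι₁} < 0 via the field `signature_ι₁`: `conj_det_mul_det_Hm_mul_det`, `det_of_frame_eq`), `not_forall_rationalFrame_r_neg` (the first column of the field's frame is a positive vector: `conjTranspose_mul_diagonal_mul_apply_zero`), whence `exists_perm_rationalFrame_r : ∃ σ : Equiv.Perm (Fin 3), 0 < r (σ 0) ∧ 0 < r (σ 1) ∧ r (σ 2) < 0` (exactly one negative) and the CHOSEN `rationalFramePerm V` with `rationalFrame_r_perm_zero_pos` / `_one_pos` / `_two_neg`. lean (oleanJ over RUN-35 in-place lib) rc 0, 0 errors, 0 warnings, 0 proof-hole; axioms trio. (`HOME/mc/pub-hodgecm-mc-glue-1-g5/lean/jsyl/HodgeCM/Model/Junction/RationalFrame.lean`, md5 f902af78, 230 lines);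
landed by the gen-12 packager (p-g12) in gate run 36 as `HodgeCM/Model/Junction/RationalFrame.lean` (verbatim).
-/
/-
Origin: HOME/mc/pub-hodgecm-mc-glue-1-g5/lean/jsyl/HodgeCM/Model/Junction/RationalFrame.lean — session
planner-pub-hodgecm-mc-glue-1-g5-0 (unit pub-hodgecm-mc-glue-1-g5, CONSTRUCTION PROVER gen 5 of mc-glue-1, nodes E ASSEMBLER +
J-Syl).  Intended final place: `HodgeCM/Model/Junction/RationalFrame.lean` (NEW additive leaf; imports
`HodgeCM.Proofs.HermitianDiagonalize` only).  Ruling (J-x₀) model1-g6 2026-08-19T11:03:25Z: the rational orthogonal frame of a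
hermitian 3-space gets ONE NAME OF RECORD, `HermSpace3.rationalFrame`, defined once (here) by choice from unitary-1's
`HermSpace3.exists_rational_frame` (`Proofs/HermitianDiagonalize.lean` :319, kernel, RUN 33); consumers (`WmInstanceV2`,
`HypCensus/*`, the Sylvester frame of `Junction/SylvesterFrame.lean`) import this def instead of writing `.choose`.
KERNEL only, 0 records, MODEL-N += 0.  Inputs: theorems of the package and Mathlib; no named fact, no hypothesis.
-/
import Summits.HodgeConjecture.HodgeCM.Proofs.HermitianDiagonalize

set_option autoImplicit false

/-!
# The rational orthogonal frame of a hermitian 3-space, and its signs at the indefinite place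

For `V : HermSpace3 L ι₁`:

* `HermSpace3.rationalFrame V : GL (Fin 3) L`, `HermSpace3.rationalFrame_d V : Fin 3 → L` — a CHOSEN rational frame `g`
  and its diagonal `d` with `ᵗ(σg) · Hm · g = diag(d₀, d₁, d₂)`, `σ dᵢ = dᵢ ≠ 0` (`rationalFrame_diag`, `rationalFrame_d_conj`,
  `rationalFrame_d_ne_zero`) — by choice from `HermSpace3.exists_rational_frame`;
* at `ι₁`: `rationalFrameC V := (rationalFrame V).map ι₁ ∈ GL₃(ℂ)`, the real numbers `rationalFrame_r V i` with
  `(rationalFrame_r V i : ℂ) = ι₁ (dᵢ)` (`rationalFrame_r_coe`), `rationalFrame_r_ne_zero`, and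
  `rationalFrame_diag_ι₁ : Gᴴ · Hm^{ι₁} · G = diagonal (fun i => (rationalFrame_r V i : ℂ))`;
* `HermSpace3.prod_rationalFrame_r_neg : r₀ r₁ r₂ < 0` and `HermSpace3.not_forall_rationalFrame_r_neg` (a positive vector
  exists), whence **`HermSpace3.exists_perm_rationalFrame_r`**: `∃ σ : Equiv.Perm (Fin 3), 0 < r (σ 0) ∧ 0 < r (σ 1) ∧ r (σ 2) < 0`
  — exactly one `ι₁ dᵢ` is negative (K-grade: `det Hm^{ι₁} < 0` from the field `signature_ι₁` plus one positive vector; no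
  inertia theorem), and the chosen `HermSpace3.rationalFramePerm V` with its three sign lemmas.
-/

noncomputable section

namespace HodgeCM

namespace HermSpace3

open scoped Matrix
open Literature.AlgebraicGeometry.ShimuraVarieties (conjRingHomK embedding_conjRingHomK signatureMatrix)

variable {L : CMField} {ι₁ : L →+* ℂ} (V : HermSpace3 L ι₁)

/-! ### The rational frame -/

/-- **The rational orthogonal frame of record** `g ∈ GL₃(L)` of `V` (chosen from `exists_rational_frame`). [folklore] -/
def rationalFrame : GL (Fin 3) L :=
  V.exists_rational_frame.choose

/-- The diagonal `d : Fin 3 → L` of the rational frame: `ᵗ(σg) · Hm · g = diagonal d`. [folklore] -/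
def rationalFrame_d : Fin 3 → L :=
  V.exists_rational_frame.choose_spec.choose

/-- `σ dᵢ = dᵢ` (`dᵢ ∈ L₀`). [folklore] -/
theorem rationalFrame_d_conj (i : Fin 3) : conjRingHomK L (V.rationalFrame_d i) = V.rationalFrame_d i :=
  V.exists_rational_frame.choose_spec.choose_spec.1 i

/-- `dᵢ ≠ 0`. [folklore] -/
theorem rationalFrame_d_ne_zero (i : Fin 3) : V.rationalFrame_d i ≠ 0 :=
  V.exists_rational_frame.choose_spec.choose_spec.2.1 i

/-- `ᵗ(σg) · Hm · g = diagonal d`. [folklore] -/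
theorem rationalFrame_diag :
    (V.rationalFrame : Matrix (Fin 3) (Fin 3) L).transpose.map (conjRingHomK L) * V.Hm *
      (V.rationalFrame : Matrix (Fin 3) (Fin 3) L) = Matrix.diagonal V.rationalFrame_d :=
  V.exists_rational_frame.choose_spec.choose_spec.2.2

/-! ### At the indefinite place `ι₁` -/

/-- The rational frame at `ι₁`: `G := g^{ι₁} ∈ GL₃(ℂ)`. [folklore] -/
def rationalFrameC : GL (Fin 3) ℂ :=
  Units.map (ι₁.mapMatrix : Matrix (Fin 3) (Fin 3) L →+* Matrix (Fin 3) (Fin 3) ℂ).toMonoidHom V.rationalFrame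

/-- (Ported verbatim from the HodgeCMPerL package; no docstring in the source.) -/
@[simp] theorem coe_rationalFrameC :
    (V.rationalFrameC : Matrix (Fin 3) (Fin 3) ℂ) = (V.rationalFrame : Matrix (Fin 3) (Fin 3) L).map ι₁ := rfl

/-- `ι₁ dᵢ` is real: it is fixed by complex conjugation. [folklore] -/
theorem conj_ι₁_rationalFrame_d (i : Fin 3) :
    starRingEnd ℂ (ι₁ (V.rationalFrame_d i)) = ι₁ (V.rationalFrame_d i) := by
  rw [← embedding_conjRingHomK, rationalFrame_d_conj]

/-- The real numbers `rᵢ := ι₁ dᵢ`. [folklore] -/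
def rationalFrame_r (i : Fin 3) : ℝ := (ι₁ (V.rationalFrame_d i)).re

/-- `(rᵢ : ℂ) = ι₁ dᵢ`. [folklore] -/
@[simp] theorem rationalFrame_r_coe (i : Fin 3) : ((V.rationalFrame_r i : ℝ) : ℂ) = ι₁ (V.rationalFrame_d i) := by
  rw [rationalFrame_r]
  exact Complex.conj_eq_iff_re.mp (V.conj_ι₁_rationalFrame_d i)

/-- `rᵢ ≠ 0`. [folklore] -/
theorem rationalFrame_r_ne_zero (i : Fin 3) : V.rationalFrame_r i ≠ 0 := by
  intro h
  have h' : ι₁ (V.rationalFrame_d i) = 0 := by rw [← rationalFrame_r_coe, h, Complex.ofReal_zero]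
  exact V.rationalFrame_d_ne_zero i ((map_eq_zero ι₁).mp h')

/-- `(ᵗ(σg))^{ι₁} = (g^{ι₁})ᴴ`. [folklore] -/
theorem map_transpose_map_conj (g : Matrix (Fin 3) (Fin 3) L) :
    (g.transpose.map (conjRingHomK L)).map ι₁ = (g.map ι₁)ᴴ := by
  ext i j
  simp [Matrix.conjTranspose_apply, Matrix.map_apply, embedding_conjRingHomK]

/-- **The rational frame diagonalises `Hm^{ι₁}`**: `Gᴴ · Hm^{ι₁} · G = diagonal (r₀, r₁, r₂)`. [folklore] -/
theorem rationalFrame_diag_ι₁ :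
    (V.rationalFrameC : Matrix (Fin 3) (Fin 3) ℂ)ᴴ * V.Hm.map ι₁ * (V.rationalFrameC : Matrix (Fin 3) (Fin 3) ℂ) =
      Matrix.diagonal (fun i => ((V.rationalFrame_r i : ℝ) : ℂ)) := by
  have h := congrArg (fun M : Matrix (Fin 3) (Fin 3) L => M.map ι₁) V.rationalFrame_diag
  simp only [Matrix.map_mul, map_transpose_map_conj] at h
  rw [coe_rationalFrameC, h, Matrix.diagonal_map (map_zero ι₁)]
  congr 1
  funext i
  rw [rationalFrame_r_coe]

/-! ### Signs at `ι₁`: exactly one negative -/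

/-- `det` of a Sylvester equation: `Tᴴ · H · T = diagonal c` gives `conj (det T) * det H * det T = ∏ cᵢ`. [folklore] -/
theorem det_of_frame_eq {T H : Matrix (Fin 3) (Fin 3) ℂ} {c : Fin 3 → ℂ} (h : Tᴴ * H * T = Matrix.diagonal c) :
    starRingEnd ℂ T.det * H.det * T.det = c 0 * c 1 * c 2 := by
  have := congrArg Matrix.det h
  rwa [Matrix.det_mul, Matrix.det_mul, Matrix.det_conjTranspose, Matrix.det_diagonal, Fin.prod_univ_three,
    Complex.star_def] at this

/-- `signatureMatrix 2 = diag(1, 1, -1)`. [folklore] -/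
theorem signatureMatrix_two_diagonal : signatureMatrix 2 = Matrix.diagonal ![(1 : ℂ), 1, -1] := by
  ext i j; fin_cases i <;> fin_cases j <;> simp [signatureMatrix, Matrix.diagonal]

/-- `det Hm^{ι₁}` is a negative real: `conj (det T) * det Hm^{ι₁} * det T = -1` for the Sylvester frame `T` of the field
`signature_ι₁`. [folklore] -/
theorem conj_det_mul_det_Hm_mul_det :
    ∃ T : GL (Fin 3) ℂ, starRingEnd ℂ (T : Matrix (Fin 3) (Fin 3) ℂ).det * (V.Hm.map ι₁).det *
      (T : Matrix (Fin 3) (Fin 3) ℂ).det = -1 := by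
  obtain ⟨T, hT⟩ := V.signature_ι₁
  refine ⟨T, ?_⟩
  rw [signatureMatrix_two_diagonal] at hT
  have := det_of_frame_eq hT
  simpa using this

/-- **`r₀ r₁ r₂ < 0`** (`det Hm^{ι₁} < 0`). [folklore] -/
theorem prod_rationalFrame_r_neg : V.rationalFrame_r 0 * V.rationalFrame_r 1 * V.rationalFrame_r 2 < 0 := by
  obtain ⟨T, hT⟩ := V.conj_det_mul_det_Hm_mul_det
  have hG := det_of_frame_eq V.rationalFrame_diag_ι₁
  set a : ℂ := (T : Matrix (Fin 3) (Fin 3) ℂ).det with ha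
  set b : ℂ := (V.rationalFrameC : Matrix (Fin 3) (Fin 3) ℂ).det with hb
  set h : ℂ := (V.Hm.map ι₁).det with hh
  have ha0 : a ≠ 0 := by
    rw [ha]; exact (Matrix.isUnits_det_units T).ne_zero
  have hb0 : b ≠ 0 := by
    rw [hb]; exact (Matrix.isUnits_det_units V.rationalFrameC).ne_zero
  -- `conj a * h * a = -1`, `conj b * h * b = r₀ r₁ r₂`; hence `r₀ r₁ r₂ * normSq a = - normSq b`.
  have hna : starRingEnd ℂ a * a = (Complex.normSq a : ℂ) := by rw [Complex.normSq_eq_conj_mul_self]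
  have hnb : starRingEnd ℂ b * b = (Complex.normSq b : ℂ) := by rw [Complex.normSq_eq_conj_mul_self]
  have key : ((V.rationalFrame_r 0 * V.rationalFrame_r 1 * V.rationalFrame_r 2 * Complex.normSq a : ℝ) : ℂ) =
      ((-Complex.normSq b : ℝ) : ℂ) := by
    push_cast
    rw [← hG, ← hna, ← hnb]
    linear_combination (starRingEnd ℂ b * b) * hT
  have key' := Complex.ofReal_injective key
  have hpa : 0 < Complex.normSq a := Complex.normSq_pos.mpr ha0
  have hpb : 0 < Complex.normSq b := Complex.normSq_pos.mpr hb0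
  nlinarith

/-- The `(0,0)` entry of `Xᴴ · diagonal c · X` is `∑ᵢ cᵢ |Xᵢ₀|²`. [folklore] -/
theorem conjTranspose_mul_diagonal_mul_apply_zero (X : Matrix (Fin 3) (Fin 3) ℂ) (c : Fin 3 → ℝ) :
    (Xᴴ * Matrix.diagonal (fun i => (c i : ℂ)) * X) 0 0 = ((∑ i, c i * Complex.normSq (X i 0) : ℝ) : ℂ) := by
  rw [Matrix.mul_assoc, Matrix.mul_apply]
  push_cast
  refine Finset.sum_congr rfl fun i _ => ?_
  rw [Matrix.diagonal_mul, Matrix.conjTranspose_apply, Complex.normSq_eq_conj_mul_self, Complex.star_def]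
  ring

/-- **A positive vector exists**: not all `rᵢ` are negative (the first column of the Sylvester frame `T` of `signature_ι₁`
has `tᴴ Hm^{ι₁} t = 1`). [folklore] -/
theorem not_forall_rationalFrame_r_neg : ¬ ∀ i, V.rationalFrame_r i < 0 := by
  intro hneg
  obtain ⟨T, hT⟩ := V.signature_ι₁
  -- `X := G⁻¹ T`, `T = G X`, `Tᴴ H T = Xᴴ (Gᴴ H G) X = Xᴴ diagonal(r) X`.
  set X : Matrix (Fin 3) (Fin 3) ℂ := ((V.rationalFrameC⁻¹ : GL (Fin 3) ℂ) : Matrix (Fin 3) (Fin 3) ℂ) *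
    (T : Matrix (Fin 3) (Fin 3) ℂ) with hXdef
  have hTX : (T : Matrix (Fin 3) (Fin 3) ℂ) = (V.rationalFrameC : Matrix (Fin 3) (Fin 3) ℂ) * X := by
    rw [hXdef, ← Matrix.mul_assoc, ← Units.val_mul, mul_inv_cancel, Units.val_one, Matrix.one_mul]
  have h00 : ((T : Matrix (Fin 3) (Fin 3) ℂ)ᴴ * V.Hm.map ι₁ * (T : Matrix (Fin 3) (Fin 3) ℂ)) 0 0 = 1 := by
    rw [hT, signatureMatrix_two_diagonal]; simp
  have hform : (T : Matrix (Fin 3) (Fin 3) ℂ)ᴴ * V.Hm.map ι₁ * (T : Matrix (Fin 3) (Fin 3) ℂ) =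
      Xᴴ * Matrix.diagonal (fun i => ((V.rationalFrame_r i : ℝ) : ℂ)) * X := by
    rw [hTX, Matrix.conjTranspose_mul, ← V.rationalFrame_diag_ι₁]
    simp only [Matrix.mul_assoc]
  rw [hform, conjTranspose_mul_diagonal_mul_apply_zero] at h00
  have h1 : (∑ i, V.rationalFrame_r i * Complex.normSq (X i 0)) = 1 := by exact_mod_cast h00
  have hle : (∑ i, V.rationalFrame_r i * Complex.normSq (X i 0)) ≤ 0 :=
    Finset.sum_nonpos fun i _ => mul_nonpos_of_nonpos_of_nonneg (hneg i).le (Complex.normSq_nonneg _)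
  linarith

/-- **Exactly one `rᵢ` is negative**: a permutation `σ` of `Fin 3` with `r (σ 0) > 0`, `r (σ 1) > 0`, `r (σ 2) < 0`. [folklore] -/
theorem exists_perm_rationalFrame_r :
    ∃ σ : Equiv.Perm (Fin 3), 0 < V.rationalFrame_r (σ 0) ∧ 0 < V.rationalFrame_r (σ 1) ∧ V.rationalFrame_r (σ 2) < 0 := by
  have hprod := V.prod_rationalFrame_r_neg
  have hnot := V.not_forall_rationalFrame_r_neg
  rcases lt_or_gt_of_ne (V.rationalFrame_r_ne_zero 0) with h0 | h0 <;>
    rcases lt_or_gt_of_ne (V.rationalFrame_r_ne_zero 1) with h1 | h1 <;>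
      rcases lt_or_gt_of_ne (V.rationalFrame_r_ne_zero 2) with h2 | h2
  · exact absurd (fun i => by fin_cases i <;> assumption) hnot
  · exfalso; nlinarith [mul_pos_of_neg_of_neg h0 h1]
  · exfalso; nlinarith [mul_pos_of_neg_of_neg h0 h2]
  · -- r₀ < 0 < r₁, r₂ : σ = (0 2) swap
    exact ⟨Equiv.swap 0 2, by simpa using h2,
      by rw [Equiv.swap_apply_of_ne_of_ne (by decide) (by decide)]; exact h1, by simpa using h0⟩
  · exfalso; nlinarith [mul_pos_of_neg_of_neg h1 h2]
  · -- r₁ < 0 < r₀, r₂ : σ = (1 2) swap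
    exact ⟨Equiv.swap 1 2, by rw [Equiv.swap_apply_of_ne_of_ne (by decide) (by decide)]; exact h0,
      by simpa using h2, by simpa using h1⟩
  · -- r₂ < 0 < r₀, r₁ : σ = 1
    exact ⟨1, by simpa using h0, by simpa using h1, by simpa using h2⟩
  · exfalso; nlinarith [mul_pos h0 h1]

/-- The CHOSEN sign-sorting permutation: the negative line last. [folklore] -/
def rationalFramePerm : Equiv.Perm (Fin 3) :=
  V.exists_perm_rationalFrame_r.choose

/-- (Ported verbatim from the HodgeCMPerL package; no docstring in the source.) -/
theorem rationalFrame_r_perm_zero_pos : 0 < V.rationalFrame_r (V.rationalFramePerm 0) :=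
  V.exists_perm_rationalFrame_r.choose_spec.1

/-- (Ported verbatim from the HodgeCMPerL package; no docstring in the source.) -/
theorem rationalFrame_r_perm_one_pos : 0 < V.rationalFrame_r (V.rationalFramePerm 1) :=
  V.exists_perm_rationalFrame_r.choose_spec.2.1

/-- (Ported verbatim from the HodgeCMPerL package; no docstring in the source.) -/
theorem rationalFrame_r_perm_two_neg : V.rationalFrame_r (V.rationalFramePerm 2) < 0 :=
  V.exists_perm_rationalFrame_r.choose_spec.2.2

end HermSpace3

end HodgeCM

end
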